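import Summits.QuantumFields.YangMills.Theorems.AlphaInputsT3ACv3BoxStokesDefect
import Literature.MathematicalPhysics.QuantumFieldTheory.Balaban1983to89.T4ReflectionConeSharp
import HarnessLib

/-!
# `AlphaInputsT3ACv3BoxStokes` — THE CRUDE NON-ABELIAN LATTICE STOKES BOUND IS **BOX-LOCAL**: the cancellation algorithm of
# `LatticeWordStokes` never leaves a coordinate box containing the walk; hence the (0.4) loop variables at a coarse bond `c` are
# controlled by the plaquettes INSIDE the two blocks `B(c₋) ∪ B(c₊)` only — lane `pub-balaban3d`, seat alpha-2 (g4)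

WHY: see the sibling `…v3BoxStokesDefect` (bookkeeping: prefix positions, product sets, the one-plaquette commutator defect).  THIS FILE:
* §3 moving a letter rightward to the FIRST occurrence of its inverse costs one plaquette OF THE BOX per transposition, and the shortened word
  stays in the box: a transposition `m b ↦ b m` at position `p` creates the one new position `p + b`, whose coordinates are coordinates of `p`
  or of `p + m + b` (product set!) unless `b = m̄`, excluded by FIRST occurrence (`dist1_holAt_cancel_le_pi`).
* §4 ★ `dist1_holAt_le_pi`: if every prefix position of a closed word `w` from `x` lies in the product set `S` and every plaquette with lower-left
  AND upper-right corner in `S` is within `δ ≥ 0` of `1`, then `|𝒰_x(w) − 1| ≤ (|w|²/4)·δ` — the constant of `LatticeWordStokes.dist1_holAt_le`.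
* §5 ★★ `dist1_loopHol_le_twoBlock`: `|U(Γ ∪ [x,x′] ∪ (−Γ′) ∪ (−c)) − 1| ≤ (((d+2)L)²/4)·δ` as soon as the level-`j` plaquettes whose lower-left
  and upper-right corners have their blocks among `{c₋, c₊}` are within `δ` of `1` (standing range `j + 1 ≤ m + K`; the two-block box is a
  product set, `blockOf_mem_pair_iff`, and every prefix of the loop word stays in it, `T4ReflectionConeSharp.blockOf_walkEnd_take_loopWord`); ★
  `small_of_plaqSmallOn_twoBlock`: the guard `BlockAveraging.Small ℰ U c` from the same two-block hypothesis — print's locality «the bound above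
  depends on bounds for V(∂p) − 1 on Δ(p′)» for the loop variables of (0.4).
HONEST FRAMING.  Lattice combinatorics over the tree's own (0.4) words; nothing of [Balaban1985Averaging] is asserted beyond what is proved;
count-neutral helper toward R3 2′ (`stub_laneRecordsV3`, items 19935∕19936); registry untouched; nothing about d = 4, the continuum, or a mass gap.

References: T. Bałaban, Commun. Math. Phys. 98 (1985) 17–51 [Balaban1985Averaging] ((9) p.19, (19)–(20) p.21, locality p.25 «the bound
above depends on bounds for V(∂p) − 1 on Δ(p′)»); CMP 109 (1987) 249–301 [Balaban1987RG1] ((0.3)–(0.4) pp.252–253).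
-/

set_option autoImplicit false

namespace Summit.QuantumFields.YangMills.Theorems.BoxStokes

open Literature.MathematicalPhysics.QuantumFieldTheory.Balaban1983to89
open T4Continuum T4ReflectionCone LatticeWordStokes BlockAveraging
open Summit.QuantumFields.BalabanUV.T4Continuum.B13AvgCorrStokes (walkEnd_pair_comm)
open T4ReflectionConeSharp (blockOf_walkEnd_take_loopWord)

variable {P : Params} {j : ℕ}

/-! ## §3 Moving a letter to the first occurrence of its inverse, inside the box -/

section Cancel

variable {G : Type*} [GaugeGroup G] (U : GaugeField P j G) {I : Fin P.d → Set (ZMod (P.sitesPerDir j))}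

/-- **MOVING `m` RIGHTWARD THROUGH `B` (no `m̄` in `B`) TO ITS PARTNER COSTS `|B|` PLAQUETTES OF THE BOX, AND THE SHORTENED WORD STAYS IN
THE BOX**: if all prefix positions of `A m B m̄ C` lie in the product set then `|𝒰_x(A m B m̄ C) − 1| ≤ |B|·δ + |𝒰_x(A B C) − 1|` and all
prefix positions of `A B C` lie in the product set. [cite: Balaban1985Averaging, (19)-(20) p.21] -/
theorem dist1_holAt_cancel_le_pi {δ : ℝ} (hδ : 0 ≤ δ)
    (hU : ∀ q : Plaq P j, q.src ∈ {z : Site P j | ∀ κ, z κ ∈ I κ} → (q.src.shift q.μ).shift q.ν ∈ {z : Site P j | ∀ κ, z κ ∈ I κ} → dist1 (GaugeField.plaqHol U q) ≤ δ)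
    (x : Site P j) (m : Letter P.d) :
    ∀ (B A C : List (Letter P.d)), m.flip ∉ B → (∀ i, walkEnd x ((A ++ m :: (B ++ m.flip :: C)).take i) ∈ {z : Site P j | ∀ κ, z κ ∈ I κ}) →
      dist1 (holAt U (walk x (A ++ m :: (B ++ m.flip :: C)))) ≤ (B.length : ℝ) * δ + dist1 (holAt U (walk x (A ++ (B ++ C)))) ∧
        ∀ i, walkEnd x ((A ++ (B ++ C)).take i) ∈ {z : Site P j | ∀ κ, z κ ∈ I κ}
  | [], A, C, _, hS => by
    simp only [List.nil_append, List.length_nil, Nat.cast_zero, zero_mul, zero_add] at hS ⊢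
    refine ⟨by rw [holAt_walk_backtrack], ?_⟩
    rw [forall_take_append_iff] at hS ⊢
    obtain ⟨hA, hrest⟩ := hS
    refine ⟨hA, ?_⟩
    rw [forall_take_cons_iff] at hrest
    obtain ⟨hy, hrest⟩ := hrest
    rw [forall_take_cons_iff, ← walkEnd_cons_eq, walkEnd_pair_flip] at hrest
    exact hrest.2
  | b :: B, A, C, hB, hS => by
    have hbm : b ≠ m.flip := fun h => hB (h ▸ List.mem_cons_self)
    have hB' : m.flip ∉ B := fun h => hB (List.mem_cons_of_mem _ h)
    -- positions around the transposition: `y = x + A`, `y + m`, `y + m + b`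
    have hS' := hS
    rw [forall_take_append_iff] at hS'
    obtain ⟨hA, hrest⟩ := hS'
    rw [forall_take_cons_iff] at hrest
    obtain ⟨hy, hrest⟩ := hrest
    rw [List.cons_append, forall_take_cons_iff, ← walkEnd_cons_eq] at hrest
    obtain ⟨hym, hrest⟩ := hrest
    have hymb : walkEnd (walkEnd x A) [m, b] ∈ {z : Site P j | ∀ κ, z κ ∈ I κ} := hrest 0
    -- the new position `y + b` lies in the box (coordinate mixing, or `b = m`)
    have hyb : walkEnd (walkEnd x A) [b] ∈ {z : Site P j | ∀ κ, z κ ∈ I κ} := by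
      by_cases hdir : m.1 = b.1
      · have hb : b = m := by
          obtain ⟨a, s⟩ := m
          obtain ⟨a', s'⟩ := b
          simp only at hdir
          subst hdir
          have : s' ≠ !s := fun h => hbm (by rw [h]; rfl)
          cases s <;> cases s' <;> simp_all
        rw [hb]; exact hym
      · exact (walkEnd_single_mem_pi hdir hy hymb).2
    -- the swapped word stays in the box
    have heq : walkEnd (walkEnd (walkEnd x A) [b]) [m] = walkEnd (walkEnd x A) [m, b] := by
      rw [← walkEnd_cons_eq, walkEnd_pair_comm]
    have hSswap : ∀ i, walkEnd x (((A ++ [b]) ++ m :: (B ++ m.flip :: C)).take i) ∈ {z : Site P j | ∀ κ, z κ ∈ I κ} := by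
      rw [forall_take_append_iff, forall_take_append_iff]
      refine ⟨⟨hA, fun i => ?_⟩, ?_⟩
      · rcases Nat.eq_zero_or_pos i with rfl | hi
        · exact hy
        · rw [List.take_of_length_le (by simp; omega)]; exact hyb
      · rw [forall_take_cons_iff, walkEnd_append, heq]
        exact ⟨hyb, hrest⟩
    have h₁ : A ++ m :: (b :: B ++ m.flip :: C) = A ++ m :: b :: (B ++ m.flip :: C) := by simp
    have h₂ : A ++ b :: m :: (B ++ m.flip :: C) = (A ++ [b]) ++ m :: (B ++ m.flip :: C) := by simp
    have h₃ : A ++ (b :: B ++ C) = (A ++ [b]) ++ (B ++ C) := by simp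
    obtain ⟨ih1, ih2⟩ := dist1_holAt_cancel_le_pi hδ hU x m B (A ++ [b]) C hB' hSswap
    refine ⟨?_, by rw [h₃]; exact ih2⟩
    calc dist1 (holAt U (walk x (A ++ m :: (b :: B ++ m.flip :: C))))
        ≤ δ + dist1 (holAt U (walk x (A ++ b :: m :: (B ++ m.flip :: C)))) := by
          rw [h₁]; exact dist1_holAt_swap_le_pi U hδ hU x A _ m b hy hymb
      _ ≤ δ + ((B.length : ℝ) * δ + dist1 (holAt U (walk x (A ++ (b :: B ++ C))))) := by
          rw [h₂, h₃]
          exact add_le_add le_rfl ih1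
      _ = ((b :: B).length : ℝ) * δ + dist1 (holAt U (walk x (A ++ (b :: B ++ C)))) := by
          simp only [List.length_cons, Nat.cast_succ]
          ring

end Cancel

/-! ## §4 The bound for closed words inside a product set -/

section Main

variable {G : Type*} [GaugeGroup G] (U : GaugeField P j G) {I : Fin P.d → Set (ZMod (P.sitesPerDir j))}

/-- A word with positive net displacement in direction `a` contains the letter `+e_a`; with negative, the letter `−e_a`. [folklore] -/
private theorem mem_of_netDisp_ne (a : Fin P.d) : ∀ (w : List (Letter P.d)),
    (0 < netDisp w a → (a, true) ∈ w) ∧ (netDisp w a < 0 → (a, false) ∈ w)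
  | [] => by simp [netDisp]
  | l :: w => by
    obtain ⟨hpos, hneg⟩ := mem_of_netDisp_ne a w
    obtain ⟨b, s⟩ := l
    constructor
    · intro h
      rw [netDisp_cons] at h
      by_cases hb : b = a
      · subst hb
        cases s
        · exact List.mem_cons_of_mem _ (hpos (by simp at h; linarith))
        · exact List.mem_cons_self
      · exact List.mem_cons_of_mem _ (hpos (by simp [hb] at h; exact h))
    · intro h
      rw [netDisp_cons] at h
      by_cases hb : b = a
      · subst hb
        cases s
        · exact List.mem_cons_self
        · exact List.mem_cons_of_mem _ (hneg (by simp at h; linarith))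
      · exact List.mem_cons_of_mem _ (hneg (by simp [hb] at h; exact h))

/-- The tail of a closed word beginning with `m` contains `m̄`. [folklore] -/
private theorem flip_mem_of_netDisp_eq_zero (m : Letter P.d) (w : List (Letter P.d)) (h : netDisp (m :: w) m.1 = 0) : m.flip ∈ w := by
  obtain ⟨a, s⟩ := m
  rw [netDisp_cons] at h
  simp only [if_true] at h
  cases s
  · exact (mem_of_netDisp_ne a w).1 (by simp at h; linarith)
  · exact (mem_of_netDisp_ne a w).2 (by simp at h; linarith)

/-- **FIRST OCCURRENCE**: a member of a list splits it at its first occurrence. [folklore] -/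
theorem exists_first_split {α : Type*} [DecidableEq α] (a : α) : ∀ (l : List α), a ∈ l → ∃ s t : List α, l = s ++ a :: t ∧ a ∉ s
  | [], h => by simp at h
  | b :: l, h => by
    by_cases hb : b = a
    · exact ⟨[], l, by rw [hb]; simp, by simp⟩
    · have h' : a ∈ l := by
        rcases List.mem_cons.mp h with h | h
        · exact absurd h.symm hb
        · exact h
      obtain ⟨s, t, hl, hs⟩ := exists_first_split a l h'
      exact ⟨b :: s, t, by rw [hl]; simp, by simp [hs, Ne.symm hb]⟩

/-- Removing a cancelling pair `m … m̄` keeps every net displacement. [folklore] -/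
private theorem netDisp_remove_pair (m : Letter P.d) (B C : List (Letter P.d)) (ν : Fin P.d) :
    netDisp (m :: (B ++ m.flip :: C)) ν = netDisp (B ++ C) ν := by
  obtain ⟨a, s⟩ := m
  simp only [netDisp_cons, netDisp_append, Letter.flip]
  by_cases ha : a = ν
  · subst ha; cases s <;> simp <;> ring
  · simp [ha]

/-- **★ THE CRUDE NON-ABELIAN LATTICE STOKES BOUND, BOX-LOCAL.**  Let `S = Π_κ I_κ` be a product set of sites of `T^{(j)}` (arbitrary coordinate
sets `I_κ`).  If every plaquette whose lower-left corner and upper-right corner lie in `S` is within `δ ≥ 0` of `1`, then for every word `w` with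
zero net displacement in every direction and every base site `x` such that ALL prefix positions `walkEnd x (w.take i)` lie in `S`:
`|𝒰_x(w) − 1| ≤ (|w|²/4)·δ`.  Proof: the tree's cancellation algorithm (`LatticeWordStokes.dist1_holAt_le`) run with the first occurrence of
the inverse letter; it never leaves `S` (§3). [cite: Balaban1985Averaging, (9) p.19 and (19)-(20) p.21] -/
theorem dist1_holAt_le_pi {δ : ℝ} (hδ : 0 ≤ δ)
    (hU : ∀ q : Plaq P j, q.src ∈ {z : Site P j | ∀ κ, z κ ∈ I κ} → (q.src.shift q.μ).shift q.ν ∈ {z : Site P j | ∀ κ, z κ ∈ I κ} → dist1 (GaugeField.plaqHol U q) ≤ δ) :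
    ∀ (n : ℕ) (w : List (Letter P.d)), w.length = n → (∀ ν, netDisp w ν = 0) → ∀ x : Site P j,
      (∀ i, walkEnd x (w.take i) ∈ {z : Site P j | ∀ κ, z κ ∈ I κ}) → dist1 (holAt U (walk x w)) ≤ ((n : ℝ) ^ 2 / 4) * δ := by
  intro n
  induction n using Nat.strong_induction_on with
  | _ n ih =>
    intro w hlen hnull x hS
    cases w with
    | nil =>
      subst hlen
      simp only [walk, holAt_nil, GaugeGroup.dist1_one]
      positivity
    | cons m w' =>
      have hmem : m.flip ∈ w' := flip_mem_of_netDisp_eq_zero m w' (hnull m.1)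
      obtain ⟨B, C, hw', hB⟩ := exists_first_split m.flip w' hmem
      subst hw'
      obtain ⟨hstep, hS'⟩ := dist1_holAt_cancel_le_pi U hδ hU x m B [] C hB (by simpa using hS)
      simp only [List.nil_append] at hstep hS'
      have hnull' : ∀ ν, netDisp (B ++ C) ν = 0 := fun ν => by rw [← netDisp_remove_pair m B C ν]; exact hnull ν
      simp only [List.length_cons, List.length_append] at hlen
      have hlen' : (B ++ C).length = n - 2 := by simp; omega
      have h2n : 2 ≤ n := by omega
      have ih' := ih (n - 2) (by omega) (B ++ C) hlen' hnull' x hS'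
      have hBn : (B.length : ℝ) ≤ (n : ℝ) - 2 := by
        have h : (B.length : ℝ) + 2 ≤ n := by exact_mod_cast (show B.length + 2 ≤ n by omega)
        linarith
      have hcast : (((n - 2 : ℕ) : ℝ)) = (n : ℝ) - 2 := by rw [Nat.cast_sub h2n]; norm_num
      calc dist1 (holAt U (walk x (m :: (B ++ m.flip :: C))))
          ≤ (B.length : ℝ) * δ + dist1 (holAt U (walk x (B ++ C))) := hstep
        _ ≤ ((n : ℝ) - 2) * δ + ((((n - 2 : ℕ) : ℝ)) ^ 2 / 4) * δ := add_le_add (mul_le_mul_of_nonneg_right hBn hδ) ih'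
        _ ≤ ((n : ℝ) ^ 2 / 4) * δ := by rw [hcast]; nlinarith

/-- The same bound stated with the word's own length. [cite: Balaban1985Averaging, (9) p.19 and (19)-(20) p.21] -/
theorem dist1_holAt_le_pi' {δ : ℝ} (hδ : 0 ≤ δ)
    (hU : ∀ q : Plaq P j, q.src ∈ {z : Site P j | ∀ κ, z κ ∈ I κ} → (q.src.shift q.μ).shift q.ν ∈ {z : Site P j | ∀ κ, z κ ∈ I κ} → dist1 (GaugeField.plaqHol U q) ≤ δ)
    (w : List (Letter P.d)) (hw : ∀ ν, netDisp w ν = 0) (x : Site P j) (hS : ∀ i, walkEnd x (w.take i) ∈ {z : Site P j | ∀ κ, z κ ∈ I κ}) :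
    dist1 (holAt U (walk x w)) ≤ ((w.length : ℝ) ^ 2 / 4) * δ :=
  dist1_holAt_le_pi U hδ hU w.length w rfl hw x hS

end Main

/-! ## §5 The (0.4) loop variables at `c` from the plaquettes of the two blocks `B(c₋) ∪ B(c₊)` -/

section TwoBlock

variable {G : Type*} [GaugeGroup G]

/-- **THE TWO-BLOCK BOX OF A COARSE BOND IS A PRODUCT SET**: `blockOf z ∈ {c₋, c₊}` iff every coordinate of `z` has its block coordinate among
those of `c₋`, `c₊` (the two coarse sites differ in the coordinate `c.dir` only). [folklore] -/
theorem blockOf_mem_pair_iff (c : PBond P (j + 1)) (z : Site P j) :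
    (blockOf z = c.src ∨ blockOf z = c.tgt) ↔
      z ∈ {z : Site P j | ∀ κ, z κ ∈ (fun κ => {t : ZMod (P.sitesPerDir j) |
        (((t.val / P.L : ℕ) : ZMod (P.sitesPerDir (j + 1))) = c.src κ) ∨ (((t.val / P.L : ℕ) : ZMod (P.sitesPerDir (j + 1))) = c.tgt κ)}) κ} := by
  simp only [Set.mem_setOf_eq]
  constructor
  · rintro (h | h) κ
    · exact Or.inl (by rw [← h]; rfl)
    · exact Or.inr (by rw [← h]; rfl)
  · intro h
    by_cases hd : blockOf z c.dir = c.src c.dir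
    · left
      funext κ
      by_cases hκ : κ = c.dir
      · rw [hκ]; exact hd
      · rcases h κ with h1 | h1
        · exact h1
        · rw [show blockOf z κ = ((((z κ).val / P.L : ℕ)) : ZMod (P.sitesPerDir (j + 1))) from rfl, h1, PBond.tgt, Site.shift_apply,
            if_neg hκ]
    · right
      funext κ
      by_cases hκ : κ = c.dir
      · subst hκ
        rcases h c.dir with h1 | h1
        · exact absurd h1 hd
        · exact h1
      · rcases h κ with h1 | h1
        · rw [show blockOf z κ = ((((z κ).val / P.L : ℕ)) : ZMod (P.sitesPerDir (j + 1))) from rfl, h1, PBond.tgt, Site.shift_apply,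
            if_neg hκ]
        · exact h1

/-- **★★ THE (0.4) LOOP VARIABLES ARE CONTROLLED BY THE PLAQUETTES OF THE TWO BLOCKS `B(c₋) ∪ B(c₊)` ONLY** (standing range
`j + 1 ≤ m + K`): if every level-`j` plaquette whose lower-left and upper-right corners have their blocks among `{c₋, c₊}` is within `δ ≥ 0` of
`1`, then every loop variable `U(Γ ∪ [x,x′] ∪ (−Γ′) ∪ (−c))` at `c` is within `(((d+2)L)²/4)·δ` of `1` — the constant of the global
`LatticeWordStokes.dist1_loopHol_le`, with print's locality «the bound depends on V(∂p) − 1 on Δ(p′)». [cite: Balaban1985Averaging, (19)–(20) p.21, p.25; Balaban1987RG1, (0.4) p.253] -/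
theorem dist1_loopHol_le_twoBlock (hj : j + 1 ≤ P.m + P.K) {δ : ℝ} (hδ : 0 ≤ δ) {U : GaugeField P j G} (c : PBond P (j + 1))
    (hU : ∀ q : Plaq P j, (blockOf q.src = c.src ∨ blockOf q.src = c.tgt) →
      (blockOf ((q.src.shift q.μ).shift q.ν) = c.src ∨ blockOf ((q.src.shift q.μ).shift q.ν) = c.tgt) →
      dist1 (GaugeField.plaqHol U q) ≤ δ)
    (i : Idx P) : dist1 (loopHol U c i) ≤ ((((P.d + 2) * P.L : ℕ) : ℝ) ^ 2 / 4) * δ := by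
  have h := dist1_holAt_le_pi' U hδ (fun q h1 h2 => hU q ((blockOf_mem_pair_iff c _).2 h1) ((blockOf_mem_pair_iff c _).2 h2))
    (loopWord P.L c.dir (off i.1) i.2.1 i.2.2) (netDisp_loopWord _ _ _ _ _) (emb c.src)
    (fun k => (blockOf_mem_pair_iff c _).1 (blockOf_walkEnd_take_loopWord hj c i k))
  refine h.trans (mul_le_mul_of_nonneg_right ?_ hδ)
  have hlen : ((loopWord P.L c.dir (off i.1) i.2.1 i.2.2).length : ℝ) ≤ (((P.d + 2) * P.L : ℕ) : ℝ) := by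
    exact_mod_cast length_loopWord_le c i
  have h0 : (0 : ℝ) ≤ ((loopWord P.L c.dir (off i.1) i.2.1 i.2.2).length : ℝ) := Nat.cast_nonneg _
  nlinarith

/-- **★ THE GUARD OF THE (0.4) AVERAGING AT `c` IS INACTIVE FROM THE TWO BLOCKS ALONE**: plaquettes of the two-block box within `δ` of `1` and
`(((d+2)L)²/4)·δ < δ_ℰ` give `BlockAveraging.Small ℰ U c`. [cite: Balaban1987RG1, (0.4) p.253] -/
theorem small_of_plaqSmallOn_twoBlock (hj : j + 1 ≤ P.m + P.K) (ℰ : LoopAverage G) {δ : ℝ} (hδ : 0 ≤ δ) {U : GaugeField P j G}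
    (c : PBond P (j + 1))
    (hU : ∀ q : Plaq P j, (blockOf q.src = c.src ∨ blockOf q.src = c.tgt) →
      (blockOf ((q.src.shift q.μ).shift q.ν) = c.src ∨ blockOf ((q.src.shift q.μ).shift q.ν) = c.tgt) →
      dist1 (GaugeField.plaqHol U q) ≤ δ)
    (hδℰ : ((((P.d + 2) * P.L : ℕ) : ℝ) ^ 2 / 4) * δ < ℰ.δ) : Small ℰ U c :=
  fun i => (dist1_loopHol_le_twoBlock hj hδ c hU i).trans_lt hδℰ

end TwoBlock

end Summit.QuantumFields.YangMills.Theorems.BoxStokes
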